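import Summits.QuantumFields.BalabanUV.Beta.D1BFx.KLimitAxial
import Summits.QuantumFields.BalabanUV.Beta.D1BFx.TorusGhostLegs
import Summits.QuantumFields.BalabanUV.Beta.D1BFx.TorusGhostGram

/-!
# `BalabanUV.Beta.D1BFx.KCombine` — road «BF-x» for binder row D1, slot (K), `K-ASSEMBLY-SPEC-v2.md` §4 brick **TB5-3: COMBINE — THE `ℤ⁴` IDENTITY OF
# ROUTE T FROM THE PER-TORUS IDENTITY AND THE FOUR SOCKETS** (ruling ρ-g7-1 (4a)).  Generic in the table families: IF on every coarse torus `p k` the identity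
# of route T holds IN ARRAY CURRENCY — M-side jets, N-side jets and the two ghost-side word triples being the periodised arrays of `ℤ⁴` families `𝒱M∕𝒲M`,
# `𝒱N∕𝒲N`, the HALF-COVARIANT tower words `𝒳∕𝒳₂` (fine torus, leg `(Ggh)^`) and the two coarse-Gram word families `𝒮̃∕𝒮̃₂`, `𝒮∕𝒮₂` (coarse torus, leg `(CsqK)^`)
# — the shape FINDING F-g7-2 ∕ `GhostHalfCovariant` gives (ruling ρ-g7-5) — THEN, letting `p k → ∞` through TB5-2b `KLimitAxial.tendsto_hessT_coDressKInvStep` (M-side),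
# K-TB3c `TorusGhostLegs.tendsto_hessT_Ggh` (tower), `TorusGhostGram.tendsto_hessT_CsqK` (coarse, twice) and TB5-2a `KLimitGluon.tendsto_hessT_NlegRoad` (N-side), uniqueness of
# limits gives THE `ℤ⁴` IDENTITY
#   `hessKer G_M 𝒱M 𝒲M + (2·hessKer Ggh 𝒳 𝒳₂ + 2·hessKer CsqK 𝒮̃ 𝒮̃₂ − hessKer CsqK 𝒮 𝒮₂) = hessKer (NlegRoad m a) 𝒱N 𝒲N` (at `μ ν z`),
# `G_M = coDressKBmAt (toSite r) (m+1) (KInvStep (m+1) 0)` (the literal's dressed one-step resolvent).  §2 reduces the array-currency hypothesis to the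
# per-torus identity in MATRIX currency (the output of `KGhostTerm(Words).hessT_transfer_road_(ghost|words)`) plus the DICTIONARY letters (TB4 (T1): table jets
# `× S_g` = M-arrays, N-jets = N-arrays; «TB4-W» 3b ∕ «HALF-WORD ARRAYS»: site words = tower arrays; coarse words = coarse arrays), via TB1∕TB5-2b `hessT_inv_MT_corner` and
# `hessT_submatrix_unit`

HONEST FRAMING (cell contract, verbatim): «discharging `BetaPertH` makes Bałaban's UV stability UNCONDITIONAL — a real constructive-QFT
result; it is NOT the continuum limit and NOT the Clay problem.»  HONEST DEPENDENCY (verbatim): «continuum YM on T⁴ ⇐ BetaPertH ∧ nine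
spine estimates (0/9 proved); BetaPertH ⇐ (D1) ∧ (D4) ∧ CAP+tail; G-an2-4 gates asym, D1 and NE2/3/4.»  THIS MODULE DISCHARGES NOTHING of
D1 / BetaPertH: [folklore] `tendsto_nhds_unique` + compositions BY NAME of this lineage's TB5-2a∕2b∕2c sockets.  No `def`, no `def … : Prop`, nothing
cited, 0 sorry.  DISPLAYED (what (K) still owes): the per-torus identity in array currency — i.e. TB4 (T1) (for the literal of record JsB12Sym per
R-D1-g25-1: the S_D-symmetrised tables, via «TB1-SYM»∕«3c-SYM»), «TB4-W» 3b, TB5-2c-B PART 2 — and `Spr (Ga (m+1) a)` (printed [B5, Prop. 1.2] ∧ [(1.126)–(1.127)]).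
The X₄ read-out of the right side against an END (F-g7-1) is NOT here.  NOT summit progress; NOT BetaPertH, NOT continuum, NOT Clay.

ABSOLUTE RULE (cell, verbatim): «No internally-minted statement may enter as a cited fact. Every hypothesis is either kernel-proved in this
package or a verbatim quotation of a PUBLISHED theorem with page reference. The manuscript(s) under audit are NOT citable for their own
disputed steps — they are the thing under adjudication; programme-internal (2001/route/tribunal) claims are never citable.»

CONTENT (all [folklore]).
* §1 `eq_of_tendsto_identity` — limits of a `k`-indexed identity `a k + (2·b k − c k) = d k`.
* §2 **`identity_array_currency`** — per torus: matrix-currency identity + dictionary letters ⟹ array-currency identity.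
* §3 **`hessKer_transfer_road`** — THE `ℤ⁴` IDENTITY OF ROUTE T modulo the array-currency identity on every torus.
Unit `b2b-balaban-beta-d1-p2` (road owner, gen 7).
-/

noncomputable section

namespace Summit.QuantumFields.BalabanUV.Beta.D1BFx.KCombine

open Filter Topology
open scoped BigOperators
open Literature.Probability.LatticeModels (TorusSite Torus.proj)
open Literature.MathematicalPhysics.QuantumFieldTheory.Balaban1983to89
open Literature.MathematicalPhysics.QuantumFieldTheory.Balaban1983to89.Beta
open Literature.MathematicalPhysics.QuantumFieldTheory.Balaban1983to89.Beta.Composition (kkt)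
open ExpKernelCalculus (MKer Decays BiLoc hessKer shiftK)
open AffineAveraging (box toSite)
open OneStepResolventKernel (Fib)
open OneStepKernelFamily (KInvStep)
open Summit.QuantumFields.BalabanUV.Beta.TameKernelCalculus (Spr)
open Summit.QuantumFields.BalabanUV.Beta.AxialDressingRooted (coDressKBmAt)
open Summit.QuantumFields.BalabanUV.Beta.D1BFx.FibredPeriodisation (periodiseF)
open Summit.QuantumFields.BalabanUV.Beta.D1BFx.SortedKernels (blocksHat)
open Summit.QuantumFields.BalabanUV.Beta.D1BFx.SortedPack (sortK)
open Summit.QuantumFields.BalabanUV.Beta.D1BFx.PeriodicArrays (arr toF)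
open Summit.QuantumFields.BalabanUV.Beta.D1BFx.MixedVarPackedHess (hessT)
open Summit.QuantumFields.BalabanUV.Beta.D1BFx.TorusCombKKT (I J CombRows tauT Khat Qhat)
open Summit.QuantumFields.BalabanUV.Beta.D1BFx.RWeightedLegPack (NlegRoad)
open Summit.QuantumFields.BalabanUV.Beta.D1BFx.KLimitGluon (tendsto_hessT_NlegRoad)
open Summit.QuantumFields.BalabanUV.Beta.D1BFx.KLimitAxial (hessT_inv_MT_corner tendsto_hessT_coDressKInvStep)
open Summit.QuantumFields.BalabanUV.Beta.D1BFx.GhostLeg (Ggh)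
open Summit.QuantumFields.BalabanUV.Beta.D1BFx.TorusGhostLegs (tendsto_hessT_Ggh)
open Summit.QuantumFields.BalabanUV.Beta.D1BFx.TorusGhostGram (CsqK tendsto_hessT_CsqK)
open Summit.QuantumFields.BalabanUV.Beta.D1BFx.SortedEmbedding (hessT_submatrix_equiv)

/-! ## §1 Limits of a `k`-indexed identity -/

/-- [folklore] If `a k + (2·b k + 2·c k − c′ k) = d k` for every `k` and the five sequences converge, the limits satisfy the same identity. -/
theorem eq_of_tendsto_identity {a b c c' d : ℕ → ℝ} {A B C C' D : ℝ} (h : ∀ k, a k + (2 * b k + 2 * c k - c' k) = d k)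
    (ha : Tendsto a atTop (𝓝 A)) (hb : Tendsto b atTop (𝓝 B)) (hc : Tendsto c atTop (𝓝 C)) (hc' : Tendsto c' atTop (𝓝 C')) (hd : Tendsto d atTop (𝓝 D)) :
    A + (2 * B + 2 * C - C') = D := by
  have h1 : Tendsto (fun k => a k + (2 * b k + 2 * c k - c' k)) atTop (𝓝 (A + (2 * B + 2 * C - C'))) :=
    ha.add (((hb.const_mul 2).add (hc.const_mul 2)).sub hc')
  have h2 : Tendsto (fun k => a k + (2 * b k + 2 * c k - c' k)) atTop (𝓝 D) := by
    simp only [h]; exact hd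
  exact tendsto_nhds_unique h1 h2

/-- [folklore] `hessT` is invariant under the re-indexing `x ↦ (x, ())` of all four matrices (the `Site ≃ Site × Unit` reading). -/
theorem hessT_submatrix_unit {α : Type*} [Fintype α] (L X X' Y : Matrix (α × Unit) (α × Unit) ℝ) :
    hessT (L.submatrix (fun x => (x, ())) (fun y => (y, ()))) (X.submatrix (fun x => (x, ())) (fun y => (y, ())))
        (X'.submatrix (fun x => (x, ())) (fun y => (y, ()))) (Y.submatrix (fun x => (x, ())) (fun y => (y, ())))
      = hessT L X X' Y :=
  hessT_submatrix_equiv (Equiv.prodPUnit α).symm L X X' Y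

/-! ## §2 Per torus: matrix currency + dictionary letters ⟹ array currency -/

section Dictionary

variable {d n : ℕ} [NeZero n] {r : Fin (d + 1) → ℕ} (p : ℕ) [NeZero p] {s : ℕ} [NeZero s]

/-- [folklore] **THE DICTIONARY STEP, PER TORUS.**  Suppose the identity of route T holds in MATRIX currency on the coarse torus `p` (fine torus `s`, `q` coarse sites):
`hessT (M_T⁻¹|_{ν⊕μ}; JM•) + (2·hessT (Gsite; XS•) + 2·hessT (Csite; ZS•) − hessT (Csite; LS•)) = hessT (blocksHat p (sortK n NL); JN•)`
(the output of TB5-1 ∘ `GhostHalfCovariant` instantiated: tower leg `Gsite` on fine sites, coarse leg `Csite` on coarse sites), and the DICTIONARY letters: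
`JM·S_g = AM` (TB4 (T1)), `JN = AN`, `Gsite = GA.submatrix ι ι`, `XS• = AX•.submatrix ι ι` (fine `Site × Unit` reading), `Csite = CA.submatrix ι ι`, `ZS• = AZ•.submatrix ι ι`,
`LS• = AL•.submatrix ι ι` (coarse `Site × Unit` reading).  Then the identity holds in ARRAY currency with the M-leg `blocksHat p (sortK n (coDressKBmAt (toSite r) n (KInvStep n 0)))`. -/
theorem identity_array_currency (hr : r ∈ box (d + 1) n) {NL : MKer (d + 1) (Fib d)} {qs : ℕ} [NeZero qs]
    (JM JM' JM'' JN JN' JN'' AM AM' AM'' AN AN' AN'' : Matrix (I d n p ⊕ J d p) (I d n p ⊕ J d p) ℝ)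
    (Gsite XS XS' XS'' : Matrix (Site 4 s) (Site 4 s) ℝ) (GA AX AX' AX'' : Matrix (Site 4 s × Unit) (Site 4 s × Unit) ℝ)
    (Csite ZS ZS' ZS'' LS LS' LS'' : Matrix (Site 4 qs) (Site 4 qs) ℝ) (CA AZ AZ' AZ'' AL AL' AL'' : Matrix (Site 4 qs × Unit) (Site 4 qs × Unit) ℝ)
    (hT : hessT ((kkt (Khat (d := d) n p) (Matrix.fromRows (Qhat (d := d) n p) (tauT (toSite r) n p)))⁻¹.submatrix
            (Sum.map id Sum.inl) (Sum.map id Sum.inl)) JM JM' JM''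
          + (2 * hessT Gsite XS XS' XS'' + 2 * hessT Csite ZS ZS' ZS'' - hessT Csite LS LS' LS'')
        = hessT (blocksHat p (sortK n NL)) JN JN' JN'')
    (hJM : JM * Matrix.fromBlocks (1 : Matrix (I d n p) (I d n p) ℝ) 0 0 (-1 : Matrix (J d p) (J d p) ℝ) = AM)
    (hJM' : JM' * Matrix.fromBlocks (1 : Matrix (I d n p) (I d n p) ℝ) 0 0 (-1 : Matrix (J d p) (J d p) ℝ) = AM')
    (hJM'' : JM'' * Matrix.fromBlocks (1 : Matrix (I d n p) (I d n p) ℝ) 0 0 (-1 : Matrix (J d p) (J d p) ℝ) = AM'')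
    (hJN : JN = AN) (hJN' : JN' = AN') (hJN'' : JN'' = AN'')
    (hG : Gsite = GA.submatrix (fun x => (x, ())) (fun y => (y, ())))
    (hXS : XS = AX.submatrix (fun x => (x, ())) (fun y => (y, ()))) (hXS' : XS' = AX'.submatrix (fun x => (x, ())) (fun y => (y, ())))
    (hXS'' : XS'' = AX''.submatrix (fun x => (x, ())) (fun y => (y, ())))
    (hC : Csite = CA.submatrix (fun x => (x, ())) (fun y => (y, ())))
    (hZS : ZS = AZ.submatrix (fun x => (x, ())) (fun y => (y, ()))) (hZS' : ZS' = AZ'.submatrix (fun x => (x, ())) (fun y => (y, ())))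
    (hZS'' : ZS'' = AZ''.submatrix (fun x => (x, ())) (fun y => (y, ())))
    (hLS : LS = AL.submatrix (fun x => (x, ())) (fun y => (y, ()))) (hLS' : LS' = AL'.submatrix (fun x => (x, ())) (fun y => (y, ())))
    (hLS'' : LS'' = AL''.submatrix (fun x => (x, ())) (fun y => (y, ()))) :
    hessT (blocksHat p (sortK n (coDressKBmAt (toSite r) n (KInvStep (d := d) n 0)))) AM AM' AM''
        + (2 * hessT GA AX AX' AX'' + 2 * hessT CA AZ AZ' AZ'' - hessT CA AL AL' AL'')
      = hessT (blocksHat p (sortK n NL)) AN AN' AN'' := by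
  rw [hessT_inv_MT_corner hr p, hJM, hJM', hJM'', hG, hXS, hXS', hXS'', hC, hZS, hZS', hZS'', hLS, hLS', hLS'', hessT_submatrix_unit,
    hessT_submatrix_unit, hessT_submatrix_unit, hJN, hJN', hJN''] at hT
  exact hT

end Dictionary

/-! ## §3 The `ℤ⁴` identity of route T -/

section Combine

variable (m : ℕ) {a : ℝ} {r : Fin 4 → ℕ}

/-- [folklore] **TB5-3: THE `ℤ⁴` IDENTITY OF ROUTE T, MODULO THE ARRAY-CURRENCY IDENTITY ON EVERY TORUS** (shape of F-g7-2 ∕ ρ-g7-5).  For `0 < a`,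
`Spr (Ga (m+1) a)`, `r ∈ box 4 (m+1)`, packed table families `𝒱M, 𝒲M` (M-side), `𝒱N, 𝒲N` (N-side), scalar word families `𝒳, 𝒳₂` (HALF-covariant tower words, fine lattice),
`𝒮t, 𝒮t₂` and `𝒮, 𝒮₂` (coarse-Gram words, coarse lattice), all bilocalised, coarse periods `p k → ∞`: IF for every `k` the identity holds in array currency on the torus `p k`
(M∕N legs in sorted `blocksHat` currency, tower leg `(Ggh (m+1) a)^` on `Site 4 ((m+1)·p k) × Unit`, coarse leg `(CsqK (m+1) a)^` on `Site 4 (p k) × Unit`), THEN on `ℤ⁴`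
`hessKer G_M 𝒱M 𝒲M + (2·hessKer (Ggh (m+1) a) 𝒳 𝒳₂ + 2·hessKer (CsqK (m+1) a) 𝒮t 𝒮t₂ − hessKer (CsqK (m+1) a) 𝒮 𝒮₂) = hessKer (NlegRoad m a) 𝒱N 𝒲N` at `μ ν z`,
`G_M = coDressKBmAt (toSite r) (m+1) (KInvStep (m+1) 0)`. -/
theorem hessKer_transfer_road (ha : 0 < a) (hGa : Spr (GluonLeg.Ga (m + 1) a)) (hr : r ∈ box (3 + 1) (m + 1))
    (𝒱M : Fin 4 → (Fin 4 → ℤ) → MKer 4 (Fib 3)) (𝒲M : Fin 4 → (Fin 4 → ℤ) → Fin 4 → (Fin 4 → ℤ) → MKer 4 (Fib 3))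
    (𝒱N : Fin 4 → (Fin 4 → ℤ) → MKer 4 (Fib 3)) (𝒲N : Fin 4 → (Fin 4 → ℤ) → Fin 4 → (Fin 4 → ℤ) → MKer 4 (Fib 3))
    (𝒳 : Fin 4 → (Fin 4 → ℤ) → MKer 4 Unit) (𝒳₂ : Fin 4 → (Fin 4 → ℤ) → Fin 4 → (Fin 4 → ℤ) → MKer 4 Unit)
    (𝒮t : Fin 4 → (Fin 4 → ℤ) → MKer 4 Unit) (𝒮t₂ : Fin 4 → (Fin 4 → ℤ) → Fin 4 → (Fin 4 → ℤ) → MKer 4 Unit)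
    (𝒮 : Fin 4 → (Fin 4 → ℤ) → MKer 4 Unit) (𝒮₂ : Fin 4 → (Fin 4 → ℤ) → Fin 4 → (Fin 4 → ℤ) → MKer 4 Unit)
    (μ ν : Fin 4) (z : Fin 4 → ℤ)
    {PM PM' QM QM' PN PN' QN QN' PX PX' QX QX' PT PT' QT QT' PL PL' QL QL' : Fin 4 → ℤ}
    {CvM CvM' CM δM CvN CvN' CN δN CvX CvX' CX δX CvT CvT' CT δT CvL CvL' CL δL : ℝ}
    (hVM : BiLoc (𝒱M μ 0) PM PM' CvM δM) (hVM' : BiLoc (𝒱M ν z) QM' QM CvM' δM) (hWM : BiLoc (𝒲M μ 0 ν z) PM QM CM δM) (hδM : 0 < δM)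
    (hVN : BiLoc (𝒱N μ 0) PN PN' CvN δN) (hVN' : BiLoc (𝒱N ν z) QN' QN CvN' δN) (hWN : BiLoc (𝒲N μ 0 ν z) PN QN CN δN) (hδN : 0 < δN)
    (hVX : BiLoc (𝒳 μ 0) PX PX' CvX δX) (hVX' : BiLoc (𝒳 ν z) QX' QX CvX' δX) (hWX : BiLoc (𝒳₂ μ 0 ν z) PX QX CX δX) (hδX : 0 < δX)
    (hVT : BiLoc (𝒮t μ 0) PT PT' CvT δT) (hVT' : BiLoc (𝒮t ν z) QT' QT CvT' δT) (hWT : BiLoc (𝒮t₂ μ 0 ν z) PT QT CT δT) (hδT : 0 < δT)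
    (hVL : BiLoc (𝒮 μ 0) PL PL' CvL δL) (hVL' : BiLoc (𝒮 ν z) QL' QL CvL' δL) (hWL : BiLoc (𝒮₂ μ 0 ν z) PL QL CL δL) (hδL : 0 < δL)
    {p : ℕ → ℕ} [∀ k, NeZero (p k)] (hp : Tendsto p atTop atTop)
    (hId : ∀ k,
      hessT (blocksHat (p k) (sortK (m + 1) (coDressKBmAt (toSite r) (m + 1) (KInvStep (d := 3) (m + 1) 0))))
          (blocksHat (p k) (sortK (m + 1) (arr ((m + 1) * p k) (𝒱M μ 0))))
          (blocksHat (p k) (sortK (m + 1) (arr ((m + 1) * p k) (𝒱M ν z))))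
          (blocksHat (p k) (sortK (m + 1) (arr ((m + 1) * p k) (𝒲M μ 0 ν z))))
        + (2 * hessT (Matrix.of (periodiseF ((m + 1) * p k) (toF (Ggh (m + 1) a))))
              (Matrix.of (periodiseF ((m + 1) * p k) (toF (arr ((m + 1) * p k) (𝒳 μ 0)))))
              (Matrix.of (periodiseF ((m + 1) * p k) (toF (arr ((m + 1) * p k) (𝒳 ν z)))))
              (Matrix.of (periodiseF ((m + 1) * p k) (toF (arr ((m + 1) * p k) (𝒳₂ μ 0 ν z)))))
            + 2 * hessT (Matrix.of (periodiseF (p k) (toF (CsqK (m + 1) a))))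
              (Matrix.of (periodiseF (p k) (toF (arr (p k) (𝒮t μ 0)))))
              (Matrix.of (periodiseF (p k) (toF (arr (p k) (𝒮t ν z)))))
              (Matrix.of (periodiseF (p k) (toF (arr (p k) (𝒮t₂ μ 0 ν z)))))
            - hessT (Matrix.of (periodiseF (p k) (toF (CsqK (m + 1) a))))
              (Matrix.of (periodiseF (p k) (toF (arr (p k) (𝒮 μ 0)))))
              (Matrix.of (periodiseF (p k) (toF (arr (p k) (𝒮 ν z)))))
              (Matrix.of (periodiseF (p k) (toF (arr (p k) (𝒮₂ μ 0 ν z))))))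
      = hessT (blocksHat (p k) (sortK (m + 1) (NlegRoad m a)))
          (blocksHat (p k) (sortK (m + 1) (arr ((m + 1) * p k) (𝒱N μ 0))))
          (blocksHat (p k) (sortK (m + 1) (arr ((m + 1) * p k) (𝒱N ν z))))
          (blocksHat (p k) (sortK (m + 1) (arr ((m + 1) * p k) (𝒲N μ 0 ν z))))) :
    hessKer (coDressKBmAt (toSite r) (m + 1) (KInvStep (d := 3) (m + 1) 0)) 𝒱M 𝒲M μ ν z
        + (2 * hessKer (Ggh (m + 1) a) 𝒳 𝒳₂ μ ν z + 2 * hessKer (CsqK (m + 1) a) 𝒮t 𝒮t₂ μ ν z - hessKer (CsqK (m + 1) a) 𝒮 𝒮₂ μ ν z)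
      = hessKer (NlegRoad m a) 𝒱N 𝒲N μ ν z :=
  eq_of_tendsto_identity hId
    (tendsto_hessT_coDressKInvStep (d := 3) hr 𝒱M 𝒲M μ ν z hVM hVM' hWM hδM hp)
    (tendsto_hessT_Ggh (m + 1) a ha 𝒳 𝒳₂ μ ν z hVX hVX' hWX hδX hp)
    (tendsto_hessT_CsqK (m + 1) a ha 𝒮t 𝒮t₂ μ ν z hVT hVT' hWT hδT hp)
    (tendsto_hessT_CsqK (m + 1) a ha 𝒮 𝒮₂ μ ν z hVL hVL' hWL hδL hp)
    (tendsto_hessT_NlegRoad m hGa 𝒱N 𝒲N μ ν z hVN hVN' hWN hδN hp)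

end Combine

/-! ## §4 (v2.1, ruling ρ-g7-8) The `ℤ⁴` identity with k-INDEXED N-side table families

leaf-03-g9's Q-leaf03-N3: the dressed gluon tables `Π̂ᵀ𝒱_MΠ̂ + ℬ` and the mixed straight weight jet `ℬ₂` contain two-array monomials with a
NON-LOCAL leg between the bond-localised factors; on the torus these are arrays of an `s`-DEPENDENT `ℤ⁴` family (wrap-around through the
leg), so the per-torus identity holds with k-indexed families `𝒱N k`, `𝒲N k` only.  The N-side limit is then supplied as ONE hypothesis `hN`
(socket «tendsto_hessT_hessKer_of_uniform», leaf-03-g9: uniform `BiLoc` + entrywise convergence ⟹ the limit is `hessKer (NlegRoad m a) 𝒱N∞ 𝒲N∞`),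
and the conclusion is the `ℤ⁴` identity with that limit value `D`.  The M-side and the ghost∕coarse slots keep their fixed families and
their four sockets BY NAME, exactly as in §3. -/

section CombineFamily

variable (m : ℕ) {a : ℝ} {r : Fin (3 + 1) → ℕ}

/-- [folklore] **TB5-3 v2.1 — THE `ℤ⁴` IDENTITY OF ROUTE T WITH k-INDEXED N-SIDE FAMILIES.**  As `hessKer_transfer_road`, but the N-side
vertex∕table families `𝒱N k`, `𝒲N k` depend on the torus index `k` and their limit enters as the hypothesis
`hN : Tendsto (k ↦ hessT (N-side at k)) atTop (𝓝 D)`; conclusion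
`hessKer G_M 𝒱M 𝒲M + (2·hessKer Ggh 𝒳 𝒳₂ + 2·hessKer CsqK 𝒮t 𝒮t₂ − hessKer CsqK 𝒮 𝒮₂) = D` at `(μ, ν, z)`. -/
theorem hessKer_transfer_road_family (ha : 0 < a) (hr : r ∈ box (3 + 1) (m + 1))
    (𝒱M : Fin 4 → (Fin 4 → ℤ) → MKer 4 (Fib 3)) (𝒲M : Fin 4 → (Fin 4 → ℤ) → Fin 4 → (Fin 4 → ℤ) → MKer 4 (Fib 3))
    (𝒱N : ℕ → Fin 4 → (Fin 4 → ℤ) → MKer 4 (Fib 3)) (𝒲N : ℕ → Fin 4 → (Fin 4 → ℤ) → Fin 4 → (Fin 4 → ℤ) → MKer 4 (Fib 3))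
    (𝒳 : Fin 4 → (Fin 4 → ℤ) → MKer 4 Unit) (𝒳₂ : Fin 4 → (Fin 4 → ℤ) → Fin 4 → (Fin 4 → ℤ) → MKer 4 Unit)
    (𝒮t : Fin 4 → (Fin 4 → ℤ) → MKer 4 Unit) (𝒮t₂ : Fin 4 → (Fin 4 → ℤ) → Fin 4 → (Fin 4 → ℤ) → MKer 4 Unit)
    (𝒮 : Fin 4 → (Fin 4 → ℤ) → MKer 4 Unit) (𝒮₂ : Fin 4 → (Fin 4 → ℤ) → Fin 4 → (Fin 4 → ℤ) → MKer 4 Unit)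
    (μ ν : Fin 4) (z : Fin 4 → ℤ) (D : ℝ)
    {PM PM' QM QM' PX PX' QX QX' PT PT' QT QT' PL PL' QL QL' : Fin 4 → ℤ}
    {CvM CvM' CM δM CvX CvX' CX δX CvT CvT' CT δT CvL CvL' CL δL : ℝ}
    (hVM : BiLoc (𝒱M μ 0) PM PM' CvM δM) (hVM' : BiLoc (𝒱M ν z) QM' QM CvM' δM) (hWM : BiLoc (𝒲M μ 0 ν z) PM QM CM δM) (hδM : 0 < δM)
    (hVX : BiLoc (𝒳 μ 0) PX PX' CvX δX) (hVX' : BiLoc (𝒳 ν z) QX' QX CvX' δX) (hWX : BiLoc (𝒳₂ μ 0 ν z) PX QX CX δX) (hδX : 0 < δX)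
    (hVT : BiLoc (𝒮t μ 0) PT PT' CvT δT) (hVT' : BiLoc (𝒮t ν z) QT' QT CvT' δT) (hWT : BiLoc (𝒮t₂ μ 0 ν z) PT QT CT δT) (hδT : 0 < δT)
    (hVL : BiLoc (𝒮 μ 0) PL PL' CvL δL) (hVL' : BiLoc (𝒮 ν z) QL' QL CvL' δL) (hWL : BiLoc (𝒮₂ μ 0 ν z) PL QL CL δL) (hδL : 0 < δL)
    {p : ℕ → ℕ} [∀ k, NeZero (p k)] (hp : Tendsto p atTop atTop)
    (hN : Tendsto (fun k =>
      hessT (blocksHat (p k) (sortK (m + 1) (NlegRoad m a)))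
        (blocksHat (p k) (sortK (m + 1) (arr ((m + 1) * p k) (𝒱N k μ 0))))
        (blocksHat (p k) (sortK (m + 1) (arr ((m + 1) * p k) (𝒱N k ν z))))
        (blocksHat (p k) (sortK (m + 1) (arr ((m + 1) * p k) (𝒲N k μ 0 ν z))))) atTop (𝓝 D))
    (hId : ∀ k,
      hessT (blocksHat (p k) (sortK (m + 1) (coDressKBmAt (toSite r) (m + 1) (KInvStep (d := 3) (m + 1) 0))))
          (blocksHat (p k) (sortK (m + 1) (arr ((m + 1) * p k) (𝒱M μ 0))))
          (blocksHat (p k) (sortK (m + 1) (arr ((m + 1) * p k) (𝒱M ν z))))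
          (blocksHat (p k) (sortK (m + 1) (arr ((m + 1) * p k) (𝒲M μ 0 ν z))))
        + (2 * hessT (Matrix.of (periodiseF ((m + 1) * p k) (toF (Ggh (m + 1) a))))
              (Matrix.of (periodiseF ((m + 1) * p k) (toF (arr ((m + 1) * p k) (𝒳 μ 0)))))
              (Matrix.of (periodiseF ((m + 1) * p k) (toF (arr ((m + 1) * p k) (𝒳 ν z)))))
              (Matrix.of (periodiseF ((m + 1) * p k) (toF (arr ((m + 1) * p k) (𝒳₂ μ 0 ν z)))))
            + 2 * hessT (Matrix.of (periodiseF (p k) (toF (CsqK (m + 1) a))))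
              (Matrix.of (periodiseF (p k) (toF (arr (p k) (𝒮t μ 0)))))
              (Matrix.of (periodiseF (p k) (toF (arr (p k) (𝒮t ν z)))))
              (Matrix.of (periodiseF (p k) (toF (arr (p k) (𝒮t₂ μ 0 ν z)))))
            - hessT (Matrix.of (periodiseF (p k) (toF (CsqK (m + 1) a))))
              (Matrix.of (periodiseF (p k) (toF (arr (p k) (𝒮 μ 0)))))
              (Matrix.of (periodiseF (p k) (toF (arr (p k) (𝒮 ν z)))))
              (Matrix.of (periodiseF (p k) (toF (arr (p k) (𝒮₂ μ 0 ν z))))))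
      = hessT (blocksHat (p k) (sortK (m + 1) (NlegRoad m a)))
          (blocksHat (p k) (sortK (m + 1) (arr ((m + 1) * p k) (𝒱N k μ 0))))
          (blocksHat (p k) (sortK (m + 1) (arr ((m + 1) * p k) (𝒱N k ν z))))
          (blocksHat (p k) (sortK (m + 1) (arr ((m + 1) * p k) (𝒲N k μ 0 ν z))))) :
    hessKer (coDressKBmAt (toSite r) (m + 1) (KInvStep (d := 3) (m + 1) 0)) 𝒱M 𝒲M μ ν z
        + (2 * hessKer (Ggh (m + 1) a) 𝒳 𝒳₂ μ ν z + 2 * hessKer (CsqK (m + 1) a) 𝒮t 𝒮t₂ μ ν z - hessKer (CsqK (m + 1) a) 𝒮 𝒮₂ μ ν z)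
      = D :=
  eq_of_tendsto_identity hId
    (tendsto_hessT_coDressKInvStep (d := 3) hr 𝒱M 𝒲M μ ν z hVM hVM' hWM hδM hp)
    (tendsto_hessT_Ggh (m + 1) a ha 𝒳 𝒳₂ μ ν z hVX hVX' hWX hδX hp)
    (tendsto_hessT_CsqK (m + 1) a ha 𝒮t 𝒮t₂ μ ν z hVT hVT' hWT hδT hp)
    (tendsto_hessT_CsqK (m + 1) a ha 𝒮 𝒮₂ μ ν z hVL hVL' hWL hδL hp)
    hN

end CombineFamily

/-! ## §5 (v2.2; ne9-leaf-02-g27's N-ne9leaf02g27-1 + ρ-g7-8) The `ℤ⁴` identity with ALL non-M slots as limit hypotheses, eventually-exact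

The coarse SECOND-order words `𝒮̃₂`, `𝒮₂` and the N-side tables are torus-exact only with s-INDEXED `ℤ⁴` families (wrap-around through a leg),
and the half-tower pure-second word is exact only once the images separate (`s > l1(u − u′)`).  The robust combine step therefore takes the
per-torus identity EVENTUALLY in `k` and the four non-M limits as plain `Tendsto` hypotheses — discharged in the dictionary by the fixed-family
sockets (`tendsto_hessT_Ggh`, `tendsto_hessT_CsqK`, `tendsto_hessT_NlegRoad`) or by leaf-03-g9's `TorusArrayLimitUniform.tendsto_hessT_hessKer_of_uniform`
for k-indexed families; only the M-side (T7 tables, `ℤ⁴`-born, exact) is kept BY NAME. -/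

section CombineLimits

variable {d : ℕ} {n : ℕ} [NeZero n] {r : Fin (d + 1) → ℕ}

/-- [folklore] Limits of an EVENTUALLY valid `k`-indexed identity `a k + (2·b k + 2·c k − c′ k) = d k`. -/
theorem eq_of_tendsto_identity_eventually {a b c c' e : ℕ → ℝ} {A B C C' E : ℝ} (h : ∀ᶠ k in atTop, a k + (2 * b k + 2 * c k - c' k) = e k)
    (ha : Tendsto a atTop (𝓝 A)) (hb : Tendsto b atTop (𝓝 B)) (hc : Tendsto c atTop (𝓝 C)) (hc' : Tendsto c' atTop (𝓝 C')) (he : Tendsto e atTop (𝓝 E)) :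
    A + (2 * B + 2 * C - C') = E := by
  have h1 : Tendsto (fun k => a k + (2 * b k + 2 * c k - c' k)) atTop (𝓝 (A + (2 * B + 2 * C - C'))) :=
    ha.add (((hb.const_mul 2).add (hc.const_mul 2)).sub hc')
  exact tendsto_nhds_unique (h1.congr' h) he

/-- [folklore] **TB5-3 v2.2 — THE `ℤ⁴` IDENTITY OF ROUTE T, M-SIDE BY NAME, EVERY OTHER SLOT A LIMIT HYPOTHESIS, EVENTUALLY-EXACT PER TORUS.**
For the M-side literal (`coDressKBmAt (toSite r) n (KInvStep n 0)`, T7 tables `𝒱M`, `𝒲M` — exact fixed `ℤ⁴` families) the slice-sorted torus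
functional converges by `KLimitAxial.tendsto_hessT_coDressKInvStep`; if the half-tower, the two coarse and the N-side torus functionals `b k`, `c k`,
`c′ k`, `e k` converge to `B`, `C`, `C′`, `E` and the per-torus identity `hessT(M-side at k) + (2·b k + 2·c k − c′ k) = e k` holds for all
large `k`, then `hessKer G_M 𝒱M 𝒲M μ ν z + (2·B + 2·C − C′) = E`. -/
theorem hessKer_transfer_road_limits (hr : r ∈ box (d + 1) n)
    (𝒱M : Fin (d + 1) → (Fin (d + 1) → ℤ) → MKer (d + 1) (Fib d))
    (𝒲M : Fin (d + 1) → (Fin (d + 1) → ℤ) → Fin (d + 1) → (Fin (d + 1) → ℤ) → MKer (d + 1) (Fib d))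
    (μ ν : Fin (d + 1)) (z : Fin (d + 1) → ℤ) {PM PM' QM QM' : Fin (d + 1) → ℤ} {CvM CvM' CM δM : ℝ}
    (hVM : BiLoc (𝒱M μ 0) PM PM' CvM δM) (hVM' : BiLoc (𝒱M ν z) QM' QM CvM' δM) (hWM : BiLoc (𝒲M μ 0 ν z) PM QM CM δM) (hδM : 0 < δM)
    {p : ℕ → ℕ} [∀ k, NeZero (p k)] (hp : Tendsto p atTop atTop)
    {b c c' e : ℕ → ℝ} {B C C' E : ℝ}
    (hb : Tendsto b atTop (𝓝 B)) (hc : Tendsto c atTop (𝓝 C)) (hc' : Tendsto c' atTop (𝓝 C')) (he : Tendsto e atTop (𝓝 E))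
    (hId : ∀ᶠ k in atTop,
      hessT (blocksHat (p k) (sortK n (coDressKBmAt (toSite r) n (KInvStep (d := d) n 0))))
          (blocksHat (p k) (sortK n (arr (n * p k) (𝒱M μ 0))))
          (blocksHat (p k) (sortK n (arr (n * p k) (𝒱M ν z))))
          (blocksHat (p k) (sortK n (arr (n * p k) (𝒲M μ 0 ν z))))
        + (2 * b k + 2 * c k - c' k) = e k) :
    hessKer (coDressKBmAt (toSite r) n (KInvStep (d := d) n 0)) 𝒱M 𝒲M μ ν z + (2 * B + 2 * C - C') = E :=
  eq_of_tendsto_identity_eventually hId (tendsto_hessT_coDressKInvStep (d := d) hr 𝒱M 𝒲M μ ν z hVM hVM' hWM hδM hp) hb hc hc' he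

end CombineLimits

end Summit.QuantumFields.BalabanUV.Beta.D1BFx.KCombine

end
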